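import Literature.AlgebraicTopology.Homotopy.WhiteheadTheorem
import Mathlib.Geometry.Manifold.Instances.Real
import HarnessLib

/-!
# Compact manifolds with boundary have the homotopy type of CW complexes (Hatcher, Cor. A.12)

Topic `Literature/AlgebraicTopology/Homotopy`, companion of `WhiteheadTheorem.lean`. That file
vendors Hatcher's Corollary A.12 — "A compact manifold is homotopy equivalent to a CW complex" —
as the named fact `Literature.AlgebraicTopology.Homotopy.exists_cwComplex_homotopyEquiv_of_compactSpace`,
but only for *closed* topological manifolds (charts on `ℝⁿ`). Hatcher's corollary covers compact
manifolds *with boundary* as well: it is deduced from Cor. A.9, "Every compact manifold, with or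
without boundary, is an ENR", and Prop. A.11 (a space dominated by a CW complex is homotopy
equivalent to a CW complex; ENRs are dominated by finite complexes, Cor. A.10/A.11). This file
vendors the with-boundary case, in the tree's encoding of compact topological manifolds with
boundary (`ChartedSpace (EuclideanHalfSpace (n + 1)) W`, `CompactSpace W`, `T2Space W`, as in
`Literature/Topology/FourManifolds/Cobordism.lean` and
`Literature/AlgebraicTopology/SingularHomology/LefschetzDuality.lean`), as the **named fact**
`Literature.AlgebraicTopology.Homotopy.exists_cwComplex_homotopyEquiv_of_compactSpace_boundary`
(D-0014: `def … : Prop`, users take it as a hypothesis), and proves from it and from Whitehead's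
theorem (Hatcher Cor. 4.33, tree named fact `whitehead_exists_homotopyEquiv`) the consequence that
is used for cobordisms:

* `Literature.AlgebraicTopology.Homotopy.exists_homotopyEquiv_of_isIso_map_of_compactManifoldBoundary`:
  a map from a simply connected closed manifold to a simply connected compact manifold with
  boundary inducing isomorphisms on all `Hₖ(-; ℤ)` is a homotopy equivalence (e.g. the inclusion
  of an end of a simply connected cobordism; Kervaire–Milnor 1963, proof of Lemma 2.3; Milnor,
  *Lectures on the h-cobordism theorem* (1965), §9).

Neither the ENR theory of manifolds nor CW approximation is in Mathlib or the tree (searched: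
`CWComplex`, `Whitehead`, `ENR`, `homotopyEquiv_of_compactSpace` in `Literature/`), so nothing
here is discharged; no declaration uses `sorry`.

## References

* A. Hatcher, *Algebraic Topology*, CUP (2002), Appendix: Cor. A.9, Cor. A.10, Prop. A.11,
  Cor. A.12; §4.2, Cor. 4.33. [HatcherAT2002]
* M. Kervaire, J. Milnor, *Groups of homotopy spheres I*, Ann. of Math. 77 (1963), proof of
  Lemma 2.3 (pp. 506–507). [KervaireMilnorAnnals1963]
-/

noncomputable section

open CategoryTheory ContinuousMap

universe u

namespace Literature.AlgebraicTopology.Homotopy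

/-- **A compact manifold with boundary is homotopy equivalent to a CW complex** (Hatcher 2002,
Appendix, Cor. A.12: "A compact manifold is homotopy equivalent to a CW complex", where by
Cor. A.9 "Every compact manifold, with or without boundary, is an ENR" and by Prop. A.11 a space
dominated by a CW complex is homotopy equivalent to one). Stated for compact Hausdorff
topological `(n+1)`-manifolds with boundary in the sense of the tree (`CompactSpace`, `T2Space`,
charts on the half-space `EuclideanHalfSpace (n + 1)`; the boundary may be empty), the companion
of `exists_cwComplex_homotopyEquiv_of_compactSpace` (the closed case, charts on `ℝⁿ`); the CW
complex is a Hausdorff space `C` of the same universe with a classical CW structure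
`Topology.CWComplex (Set.univ : Set C)`. Named fact, not proved here (no ENR theory in Mathlib or
the tree). [cite: HatcherAT2002, Appendix Cor. A.12 (with Cor. A.9 and Prop. A.11)] -/
def exists_cwComplex_homotopyEquiv_of_compactSpace_boundary : Prop :=
  ∀ (n : ℕ) (W : Type u) [TopologicalSpace W] [T2Space W] [CompactSpace W]
    [ChartedSpace (EuclideanHalfSpace (n + 1)) W],
    ∃ (C : Type u) (_ : TopologicalSpace C) (_ : T2Space C)
      (_ : Topology.CWComplex (Set.univ : Set C)), Nonempty (W ≃ₕ C)

/-- **Whitehead's theorem for a map from a closed manifold to a compact manifold with boundary**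
(Hatcher 2002, Cor. 4.33 with Cor. A.12, hypotheses `hW`, `hCW`, `hCW'`): a map `f : X → Y`
from a simply connected closed topological `m`-manifold to a simply connected compact
topological `(k+1)`-manifold with boundary inducing isomorphisms on all `Hₙ(-; ℤ)` is a homotopy
equivalence. PROVED from the three named facts, through the tree theorem
`exists_homotopyEquiv_of_isIso_map_of_homotopyEquiv_cwComplex` (`WhiteheadTheorem.lean`). This is
the form in which Whitehead's theorem is applied to the ends of a cobordism (Kervaire–Milnor
1963, proof of Lemma 2.3: "`Sⁿ → W` induces a homology isomorphism; hence `Sⁿ` is a deformation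
retract of `W`"). [cite: HatcherAT2002, Cor. 4.33 and Cor. A.12] -/
theorem exists_homotopyEquiv_of_isIso_map_of_compactManifoldBoundary
    (hW : whitehead_exists_homotopyEquiv.{u}) (hCW : exists_cwComplex_homotopyEquiv_of_compactSpace.{u})
    (hCW' : exists_cwComplex_homotopyEquiv_of_compactSpace_boundary.{u})
    {X Y : Type u} [TopologicalSpace X] [TopologicalSpace Y]
    [T2Space X] [CompactSpace X] {m : ℕ} [ChartedSpace (EuclideanSpace ℝ (Fin m)) X]
    [T2Space Y] [CompactSpace Y] {k : ℕ} [ChartedSpace (EuclideanHalfSpace (k + 1)) Y]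
    [SimplyConnectedSpace X] [SimplyConnectedSpace Y]
    (f : C(X, Y)) (hf : ∀ j : ℕ, IsIso (SingularHomology.singularHomology.map ℤ ℤ f j)) :
    ∃ e : X ≃ₕ Y, (e : X → Y) = f := by
  obtain ⟨P, _, _, _, ⟨eX⟩⟩ := hCW X m
  obtain ⟨Q, _, _, _, ⟨eY⟩⟩ := hCW' k Y
  exact exists_homotopyEquiv_of_isIso_map_of_homotopyEquiv_cwComplex hW eX eY f hf

/-- **Whitehead's theorem between compact manifolds with boundary** (Hatcher 2002, Cor. 4.33
with Cor. A.12, hypotheses `hW`, `hCW'`): a map between simply connected compact topological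
manifolds with boundary inducing isomorphisms on all `Hₙ(-; ℤ)` is a homotopy equivalence.
PROVED from the two named facts. [cite: HatcherAT2002, Cor. 4.33 and Cor. A.12] -/
theorem exists_homotopyEquiv_of_isIso_map_of_compactManifoldBoundary'
    (hW : whitehead_exists_homotopyEquiv.{u})
    (hCW' : exists_cwComplex_homotopyEquiv_of_compactSpace_boundary.{u})
    {X Y : Type u} [TopologicalSpace X] [TopologicalSpace Y]
    [T2Space X] [CompactSpace X] {m : ℕ} [ChartedSpace (EuclideanHalfSpace (m + 1)) X]
    [T2Space Y] [CompactSpace Y] {k : ℕ} [ChartedSpace (EuclideanHalfSpace (k + 1)) Y]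
    [SimplyConnectedSpace X] [SimplyConnectedSpace Y]
    (f : C(X, Y)) (hf : ∀ j : ℕ, IsIso (SingularHomology.singularHomology.map ℤ ℤ f j)) :
    ∃ e : X ≃ₕ Y, (e : X → Y) = f := by
  obtain ⟨P, _, _, _, ⟨eX⟩⟩ := hCW' m X
  obtain ⟨Q, _, _, _, ⟨eY⟩⟩ := hCW' k Y
  exact exists_homotopyEquiv_of_isIso_map_of_homotopyEquiv_cwComplex hW eX eY f hf

end Literature.AlgebraicTopology.Homotopy

end
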